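import Mathlib
import HarnessLib
import Summits.NavierStokesRegularity.NavierStokesRegularity.Theses.LocalPressureProfileDoor

/-! # BC3 — birth skeleton for the crux K2⁺ `MonotonePressureProfileRigidity` (the foreseen two-layer split).
Two named stubs (sorried) and the composition `MonotonePressureProfileRigidity_of` PROVED.
* `stub_smallSliceOfMonotonePressure` (L; THE NEW MECHANISM): door class ∧ shift-monotone similarity pressure ⇒
  for every radius factor R > 0 and every θ > 0 there is a negative time t̄ whose vorticity slice is θ-small on
  B(0, 2R√(−t̄)) in the scale-invariant normalisation of Pineau–Vicol (9.17) — the eternal head-pressure budget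
  against the parabolic adjoint weight makes ∫_{−∞}^{s₂−1} ‖Ω(s)‖²_{L²(B_{2R})} ds finite, so liminf_{s→−∞} = 0.
* `stub_regularOfSmallSlices` (M; replumb of PROVED tree theorems): door class ∧ such slices for all R, θ ⇒ the apex
  is not backward-singular — rescale the small slice to t_b = −T₀/2 (the class and the normalisation are scaling
  invariant, `lerayOrbit_nsRescale`), then `pineauVicol_smallVorticity_propagation` + `exists_cknE_le_of_core_small`
  + `pineauVicol_regular_of_zoom_small` (the chain of `pineauVicol2026_oneSlice_regularity_of_core'`). -/

namespace Summit.NavierStokesRegularity.NavierStokesRegularity.Theses.LocalPressureProfileDoor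

/-- stub 1 (L, load-bearing, the new mechanism): eternal head-pressure budget ⇒ far-past small-enstrophy slices.
INTERNAL LEMMA CHAIN (named here at the tribunal J pre-read's request, §4; they are `--supports` lemmas of this stub, not items):
(i) `doorClass_smooth` — a door-class profile (continuous slices, unit-viscosity Oseen–Duhamel mild, Type-I rate) is C^∞ in
(s,y) on every backward slab, with the scale-invariant gradient bounds |∇ᵏU| ≤ K_k(C,D): tree
`TypeICertificateLadderRungReynoldsOneOseenGaugeMild.isSmoothSpaceTimeOn_of_oseenMild` (l.118) + `exists_forall_fderiv_le_of_typeI_of_bounds`;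
(ii) `eternalAdjointWeight` — for U smooth, div-free, ‖U‖ ≤ C₀ on ℝ × ℝ³: a positive solution w of ∂ₛw + Δw + div((U+½y)w) = 0 on
s ≤ s₂ with ∫w(s) = 1, ∫|y|²w(s) ≤ R₀(C₀)² and the floor w(s,y) ≥ c(C₀,R) on B_R for s ≤ s₂ − 1 (existence = the physical backward
Kolmogorov equation ∂ₜg + Δg + v·∇g = 0 pulled back; tightness = d/dσ∫|y|²w ≤ 6 + 2C₀(∫|y|²w)^{1/2} − ∫|y|²w; floor = parabolic Harnack
`Lieberman1996_harnack_drift_gap_holds` in the gauge w̃ = e^{−3σ/2}w, chains of ≲ R² steps; cf. the ELLIPTIC weight PineauVicol2026 Prop 5.1 =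
tree `PineauVicolWeightBounds.DriftHyp.exists_weight`);
(iii) `headBudget` — ∫_{s₁}^{s₂}∫ w|Ω|² = [∫wΠ]^{s₁}_{s₂} + ∫_{s₁}^{s₂}∫ w dP ≤ 2(C_P + ½D² + ½D) when P(·,y) is non-increasing (BV in s; the
integrated form needs no pointwise ∂ₛP): `driftOp_headPressure_forced` with F = ∂ₛU (the ⟪U+½y, ∂ₛU⟫ terms cancel) + `abs_headPressure_le`;
(iv) `liminf_enstrophy_zero` — (ii)+(iii) ⇒ ∫_{−∞}^{s₂−1}‖Ω(s)‖²_{L²(B_{2R})} ds ≤ 2M/c(C₀,2R) ⇒ ∀θ ∃ s̄ ≤ s₂−1 with ‖Ω(s̄)‖²_{L²(B_{2R})} ≤ θ²/4,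
which in physical variables at t̄ = −e^{−s̄} is the (9.17)-normalised smallness below. -/
theorem stub_smallSliceOfMonotonePressure :
    ∀ (C D : ℝ) (v : ℝ → EuclideanSpace ℝ (Fin 3) → EuclideanSpace ℝ (Fin 3)),
    Literature.Analysis.FluidPDE.HasTypeITimeDecay C v →
    Literature.Analysis.FluidPDE.HasTypeIDecay D v →
    ContinuousOn (Function.uncurry v) (Set.Iio (0 : ℝ) ×ˢ Set.univ) →
    (∀ s t : ℝ, s < t → t < 0 → ∀ x, v t x =
      Literature.Analysis.UnboundedOperators.heatExtension (v s) (t - s) x -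
        Literature.Analysis.FluidPDE.oseenDuhamel 1 s v v t x) →
    (∀ t < 0, Literature.Analysis.FluidPDE.VectorCalculus.IsDivFree (v t)) →
    (∀ t < 0, ∀ σ ∈ Set.Icc (0 : ℝ) 1, ∀ y : EuclideanSpace ℝ (Fin 3),
      (-(Real.exp (-σ) * t)) * Literature.Analysis.FluidPDE.pressurePotential (v (Real.exp (-σ) * t))
          (Real.sqrt (-(Real.exp (-σ) * t)) • y) ≤
        (-t) * Literature.Analysis.FluidPDE.pressurePotential (v t) (Real.sqrt (-t) • y)) →
    ∀ R θ : ℝ, 0 < R → 0 < θ → ∃ tb : ℝ, tb < 0 ∧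
      (∫⁻ x in Metric.ball (0 : EuclideanSpace ℝ (Fin 3)) (2 * R * Real.sqrt (-tb)),
          ENNReal.ofReal (‖Literature.Analysis.FluidPDE.curl (v tb) x‖ ^ 2)) ≤
        ENNReal.ofReal (θ ^ 2 / (4 * Real.sqrt (-tb))) := by
  sorry

/-- stub 2 (M): small-enstrophy slices at every scale ⇒ regular apex (scaling transport + the proved
Pineau–Vicol propagation / CKN chain). -/
theorem stub_regularOfSmallSlices :
    ∀ (C D : ℝ) (v : ℝ → EuclideanSpace ℝ (Fin 3) → EuclideanSpace ℝ (Fin 3)),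
    Literature.Analysis.FluidPDE.HasTypeITimeDecay C v →
    Literature.Analysis.FluidPDE.HasTypeIDecay D v →
    ContinuousOn (Function.uncurry v) (Set.Iio (0 : ℝ) ×ˢ Set.univ) →
    (∀ s t : ℝ, s < t → t < 0 → ∀ x, v t x =
      Literature.Analysis.UnboundedOperators.heatExtension (v s) (t - s) x -
        Literature.Analysis.FluidPDE.oseenDuhamel 1 s v v t x) →
    (∀ t < 0, Literature.Analysis.FluidPDE.VectorCalculus.IsDivFree (v t)) →
    (∀ R θ : ℝ, 0 < R → 0 < θ → ∃ tb : ℝ, tb < 0 ∧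
      (∫⁻ x in Metric.ball (0 : EuclideanSpace ℝ (Fin 3)) (2 * R * Real.sqrt (-tb)),
          ENNReal.ofReal (‖Literature.Analysis.FluidPDE.curl (v tb) x‖ ^ 2)) ≤
        ENNReal.ofReal (θ ^ 2 / (4 * Real.sqrt (-tb)))) →
    ¬ Literature.Analysis.FluidPDE.IsBackwardSingularPoint v 0 := by
  sorry

/-- COMPOSITION (proved): K2⁺ ⇐ stub 1 → stub 2. -/
theorem MonotonePressureProfileRigidity_of : MonotonePressureProfileRigidity := by
  intro C D v hrate hdecay hcont hmild hdiv hmono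
  exact stub_regularOfSmallSlices C D v hrate hdecay hcont hmild hdiv
    (stub_smallSliceOfMonotonePressure C D v hrate hdecay hcont hmild hdiv hmono)

/-- **BC5 RUNG (plan-only, flag `T3-plan-only`; a named stub NOT consumed by `MonotonePressureProfileRigidity_of`)**:
the DISCRETELY-SELF-SIMILAR + STEADY-SIMILARITY-PRESSURE case of K2⁺ — a λ-DSS (λ > 1) profile of the door class
whose similarity Riesz pressure P(s,y) = (−t)·Q[v(t)](√(−t)y) does not depend on similarity time has a regular apex
(indeed v ≡ 0). It is a special case of K2⁺ (the shift-monotonicity hypothesis holds with equality).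
Technique (the route's lever, in its cleanest instance): the eternal head-pressure budget
∫_{−∞}^{s₂}∫ w|Ω|² dy ds ≤ 2·sup|Π| (head identity ∂ₛΠ + LΠ = −|Ω|² + ∂ₛP with ∂ₛP = 0, `driftOp_headPressure_forced`;
|Π| ≤ C_P + ½D² + ½D, `abs_headPressure_le`; parabolic adjoint weight w of unit mass with floor c(D,R) on B_R,
`Lieberman1996_harnack_drift_gap_holds`) makes s ↦ ‖Ω(s)‖²_{L²(B_R)} integrable on (−∞, s₂−1); under λ-DSS it is
(2 log λ)-periodic and continuous, hence ≡ 0; so Ω ≡ 0, and a curl-free divergence-free field with |U| ≤ D/(1+|y|) is 0.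
Why it lies OUTSIDE S's known regime: Type-I DSS blow-up is excluded in print only for factors λ near 1
(`Literature.Barriers.NavierStokesRegularity.NearOneDssTypeIExclusion`) and for exactly self-similar profiles
(Tsai1998 / NecasRuzickaSverak1996 = tree `ControlsClassLevel.typeI_ancient_selfSimilar_ae_zero`, the kernel witness);
a steady-PRESSURE λ-DSS profile with λ far from 1 is neither, and no smallness enters. -/
theorem stub_rung_dssSteadyPressure :
    ∀ (C D lam : ℝ) (v : ℝ → EuclideanSpace ℝ (Fin 3) → EuclideanSpace ℝ (Fin 3)), 1 < lam →
    Literature.Analysis.FluidPDE.HasTypeITimeDecay C v →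
    Literature.Analysis.FluidPDE.HasTypeIDecay D v →
    ContinuousOn (Function.uncurry v) (Set.Iio (0 : ℝ) ×ˢ Set.univ) →
    (∀ s t : ℝ, s < t → t < 0 → ∀ x, v t x =
      Literature.Analysis.UnboundedOperators.heatExtension (v s) (t - s) x -
        Literature.Analysis.FluidPDE.oseenDuhamel 1 s v v t x) →
    (∀ t < 0, Literature.Analysis.FluidPDE.VectorCalculus.IsDivFree (v t)) →
    Literature.Analysis.FluidPDE.IsDiscretelySelfSimilar lam v →
    (∀ s t : ℝ, s < 0 → t < 0 → ∀ y : EuclideanSpace ℝ (Fin 3),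
      (-s) * Literature.Analysis.FluidPDE.pressurePotential (v s) (Real.sqrt (-s) • y) =
        (-t) * Literature.Analysis.FluidPDE.pressurePotential (v t) (Real.sqrt (-t) • y)) →
    ¬ Literature.Analysis.FluidPDE.IsBackwardSingularPoint v 0 := by
  sorry

end Summit.NavierStokesRegularity.NavierStokesRegularity.Theses.LocalPressureProfileDoor
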